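import Summits.AnomalousDissipation.AnomalousDissipation.Theorems.SolenoidalFractalHomogenisationLagrangianStepSidebandXSidebandEnergy
import HarnessLib

/-!
# K1L_D `LagrangianRenormalisationStepDesign` (stmt-AnomalousDissipation-27980), `stub_D1_V0R` (ruling D27-1), brick T8b-2′b: POINTWISE
# SHELL AND TAIL ENERGIES — `Σ_{w ∈ box R₂ \\ box R}‖x_w(t)‖² ≤ k₀(Σ‖αⱼ‖²)ζ/(π²lo²R²)`, `tailEnergy t ≲ ξ²‖F‖²/(lo⁴R²)`
# (helper; `--kind proof --supports stmt-AnomalousDissipation-27980 --as helper`)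

Summits-side helper file of route `SolenoidalFractalHomogenisation` (prover seat `ad-k1l-cellLawV-w1` g7; 0 sorry, no defs, no named facts).
Continuation of `…SidebandXSidebandEnergy` (finding F-w1g7-2: the tail must be bounded POINTWISE in time, with the factor `ξ²`):
* §3 **`shell_energy_le`** — for the finite shell `box R₂ \\ box R` (`R ≥ max|mⱼ|_∞`): the own dissipation `4π²·lo·R²` of the shell modes beats
  their links (`|cⱼ(k)| ≤ 2π√|k|²/n`, Young against half the dissipation — `two_re_inner_rhs_le`; NO skew cancellation needed), so by Grönwall from
  `e(0) = 0`: `Σ_{w ∈ box R₂ \\ box R} ‖x_w(t)‖² ≤ k₀(Σⱼ‖αⱼ‖²)·ζ/(π²·lo²·R²)` whenever every finite set of sideband modes has energy `≤ ζ` on `[0,t]`;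
* §4 **`tailEnergy_le_pointwise`** — with `…TailBound.tailEnergy_le_shell_sum` and `…SidebandEnergy.sideband_energy_le`:
  `tailEnergy t ≤ 4k₀(Σ‖αⱼ‖²)·k₀(Σ‖αⱼ‖²)·ζ/(π²lo²R²)`, `ζ = 64ξ²‖F‖²(Σ‖αⱼ‖)²/(π²lo²)` — relative size `ξ²/(lo⁴R²) = O(ξ²ν²)` at `lo ∼ ν`,
  `R = ⌈ν⁻³⌉`.
NOT a proof of any registered stub, of K1L_D, or of anomalous dissipation; rung F-D1.A0 infrastructure.
-/

set_option linter.dupNamespace false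

noncomputable section

namespace Summit.AnomalousDissipation.AnomalousDissipation.Theorems.SolenoidalFractalHomogenisation.LagrangianStep.Sideband

open Set MeasureTheory Complex UnitAddTorus
open scoped InnerProductSpace
open Literature.Analysis Literature.Analysis.FunctionSpaces Literature.Analysis.FunctionSpaces.Torus
open Literature.Analysis.FluidPDE Literature.Analysis.FluidPDE.Torus Literature.Analysis.FluidPDE.LatticeShear
open Summit.AnomalousDissipation.AnomalousDissipation.Theorems.SolenoidalFractalHomogenisation.LagrangianStep.CellChain
  (modeRep modeRep_zero continuousOn_modeRep hasDerivAt_norm_sq_modeRep linkCoeff norm_transversalProj_le)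
open Summit.AnomalousDissipation.AnomalousDissipation.Theorems.SolenoidalFractalHomogenisation.RealisedQuasiStaticCellLaw
  (memLp_two_of_memSobolev_one_complexify memSobolev_one_singleMode)

variable {k₀ : ℕ}

/-! ## §3 The outer shell: its own dissipation beats the links -/

/-- `∫₀ᵗ e^{-σ (t - s)} ds ≤ 1/σ` (`σ > 0`, `t ≥ 0`). [folklore] -/
theorem integral_exp_neg_sub_le_inv {σ : ℝ} (hσ : 0 < σ) (t : ℝ) :
    ∫ s in (0:ℝ)..t, Real.exp (-(σ * (t - s))) ≤ 1 / σ := by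
  have hd : ∀ s, HasDerivAt (fun u => Real.exp (-(σ * (t - u))) / σ) (Real.exp (-(σ * (t - s)))) s := by
    intro s
    have h := ((((hasDerivAt_id s).const_sub t).const_mul σ).neg.exp).div_const σ
    field_simp at h
    simpa using h
  rw [intervalIntegral.integral_eq_sub_of_hasDerivAt (fun s _ => hd s)
    ((continuous_const.mul (continuous_const.sub continuous_id)).neg.rexp.intervalIntegrable _ _)]
  simp only [sub_self, mul_zero, neg_zero, Real.exp_zero]
  have h1 : 0 < Real.exp (-(σ * (t - 0))) := Real.exp_pos _
  have h2 : 1 / σ - Real.exp (-(σ * (t - 0))) / σ ≤ 1 / σ := by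
    have : 0 ≤ Real.exp (-(σ * (t - 0))) / σ := div_nonneg h1.le hσ.le
    linarith
  exact h2

/-- Off the box, `|ℓ + n·v|² ≥ n²R²` (`2|ℓ| ≤ n`, `v ∉ box R`, `v ≠ 0`). [cite: MajdaKramer1999, §2.2.1.3] -/
theorem freqNormSq_classFreq_ge_of_not_mem_box {n : ℕ} {ℓ : Fin 3 → ℤ} (hℓ : 2 * Real.sqrt (freqNormSq ℓ) ≤ n) {R : ℕ} {v : Fin 3 → ℤ}
    (hvR : v ∉ box R) (hne : v ≠ 0) : ((n : ℝ) * R) ^ 2 ≤ freqNormSq (classFreq n ℓ v) := by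
  have hbig : ∃ i, (R : ℤ) + 1 ≤ |v i| := by
    by_contra hcon
    refine hvR (mem_box.2 ⟨fun i => ?_, hne⟩)
    have hi : |v i| ≤ (R : ℤ) := by
      by_contra h'
      exact hcon ⟨i, by omega⟩
    have h2 := abs_le.1 hi
    constructor <;> linarith [h2.1, h2.2]
  obtain ⟨i, hi⟩ := hbig
  have hR1 : ((R : ℝ) + 1) ^ 2 ≤ freqNormSq v := by
    have h1 : ((R : ℝ) + 1) ^ 2 ≤ ((v i : ℤ) : ℝ) ^ 2 := by
      have : ((R : ℝ) + 1) ≤ |((v i : ℤ) : ℝ)| := by exact_mod_cast hi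
      nlinarith [abs_nonneg (((v i : ℤ) : ℝ)), sq_abs (((v i : ℤ) : ℝ))]
    exact h1.trans (Finset.single_le_sum (f := fun j => ((v j : ℤ) : ℝ) ^ 2) (fun j _ => sq_nonneg _) (Finset.mem_univ i))
  have hsq : (R : ℝ) + 1 ≤ Real.sqrt (freqNormSq v) := by
    rw [← Real.sqrt_sq (by positivity : (0:ℝ) ≤ R + 1)]; exact Real.sqrt_le_sqrt hR1
  have h := sqrt_freqNormSq_classFreq_ge n ℓ v
  have hn : (0 : ℝ) ≤ n := Nat.cast_nonneg n
  have hnR : (n : ℝ) * R ≤ Real.sqrt (freqNormSq (classFreq n ℓ v)) := by nlinarith [mul_le_mul_of_nonneg_left hsq hn]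
  calc ((n : ℝ) * R) ^ 2 ≤ Real.sqrt (freqNormSq (classFreq n ℓ v)) ^ 2 := pow_le_pow_left₀ (by positivity) hnR 2
    _ = freqNormSq (classFreq n ℓ v) := Real.sq_sqrt (freqNormSq_nonneg _)

/-- **One shell mode: the a.e.-free derivative bound.**  For `k` with `|k|² ≥ κ > 0`, transversal `x = P_k x`, `NearIso 𝔹 lo' hi'`:
`2Re⟪x, −4π²P_k T_{𝔹ᵀ}(k)x − Σⱼ cⱼ•P_k(αⱼ y⁻ⱼ + ᾱⱼ y⁺ⱼ)⟫ ≤ −4π²lo'κ‖x‖² + (Σⱼ‖αⱼ‖(‖y⁻ⱼ‖+‖y⁺ⱼ‖))²·(max|cⱼ|)²/(4π²lo'κ)` — Young against half the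
dissipation. [cite: BedrossianCotiZelati2017, §2] [cite: Temam1984, Ch. III §1 Lemma 1.2] -/
theorem two_re_inner_rhs_le {𝔹 : Torus.Visc4 (Fin 3)} {lo' hi' : ℝ} (h𝔹 : Torus.NearIso 𝔹 lo' hi') (hlo' : 0 < lo') {k : Fin 3 → ℤ}
    {κ : ℝ} (hκ : 0 < κ) (hk : κ ≤ freqNormSq k) {x : EuclideanSpace ℂ (Fin 3)} (hx : kdot k x = 0) {ι : Type*} (s : Finset ι)
    (c α α' : ι → ℂ) (ym yp : ι → EuclideanSpace ℂ (Fin 3)) {C : ℝ} (hC : 0 ≤ C) (hc : ∀ j ∈ s, ‖c j‖ ≤ C) (hαα : ∀ j ∈ s, ‖α' j‖ = ‖α j‖) :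
    2 * (⟪x, (-(((4 * Real.pi ^ 2 : ℝ) : ℂ) • transversalProj k (Torus.symbT (Torus.majorTranspose 𝔹) k x)) -
        ∑ j ∈ s, c j • transversalProj k (α j • ym j + α' j • yp j))⟫_ℂ).re ≤
      -(4 * Real.pi ^ 2 * lo' * κ) * ‖x‖ ^ 2 + C ^ 2 * (∑ j ∈ s, ‖α j‖ * (‖ym j‖ + ‖yp j‖)) ^ 2 / (4 * Real.pi ^ 2 * lo' * freqNormSq k) := by
  have hk0 : 0 < freqNormSq k := hκ.trans_le hk
  have h𝔹T : Torus.NearIso (Torus.majorTranspose 𝔹) lo' hi' := (Torus.nearIso_majorTranspose_iff 𝔹 lo' hi').2 h𝔹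
  have hx' : ∑ j, (k j : ℂ) * x j = 0 := by rw [← kdot_apply]; exact hx
  -- the dissipation
  have hdis : (⟪x, ((4 * Real.pi ^ 2 : ℝ) : ℂ) • transversalProj k (Torus.symbT (Torus.majorTranspose 𝔹) k x)⟫_ℂ).re ≥
      4 * Real.pi ^ 2 * (lo' * (freqNormSq k * ‖x‖ ^ 2)) := by
    rw [inner_smul_right, inner_transversalProj_right_of_kdot_eq_zero k hx, Complex.re_ofReal_mul]
    exact mul_le_mul_of_nonneg_left (Torus.lo_mul_le_re_inner_symbT h𝔹T hx') (by positivity)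
  -- the links
  set B : ℝ := ∑ j ∈ s, ‖α j‖ * (‖ym j‖ + ‖yp j‖) with hB
  have hB0 : 0 ≤ B := Finset.sum_nonneg fun j _ => by positivity
  have hL : ‖∑ j ∈ s, c j • transversalProj k (α j • ym j + α' j • yp j)‖ ≤ C * B := by
    calc _ ≤ ∑ j ∈ s, ‖c j • transversalProj k (α j • ym j + α' j • yp j)‖ := norm_sum_le _ _
      _ ≤ ∑ j ∈ s, C * (‖α j‖ * (‖ym j‖ + ‖yp j‖)) := Finset.sum_le_sum fun j hj => by
          rw [norm_smul]
          refine mul_le_mul (hc j hj) ((norm_transversalProj_le _ _).trans ((norm_add_le _ _).trans ?_)) (norm_nonneg _) hC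
          rw [norm_smul, norm_smul, hαα j hj, mul_add]
      _ = C * B := by rw [hB, Finset.mul_sum]
  have hlink : (⟪x, ∑ j ∈ s, c j • transversalProj k (α j • ym j + α' j • yp j)⟫_ℂ).re ≥ -(‖x‖ * (C * B)) := by
    have h1 := norm_inner_le_norm (𝕜 := ℂ) x (∑ j ∈ s, c j • transversalProj k (α j • ym j + α' j • yp j))
    have h2 := Complex.abs_re_le_norm (⟪x, ∑ j ∈ s, c j • transversalProj k (α j • ym j + α' j • yp j)⟫_ℂ)
    have h3 : ‖x‖ * ‖∑ j ∈ s, c j • transversalProj k (α j • ym j + α' j • yp j)‖ ≤ ‖x‖ * (C * B) :=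
      mul_le_mul_of_nonneg_left hL (norm_nonneg _)
    have h4 := neg_abs_le (⟪x, ∑ j ∈ s, c j • transversalProj k (α j • ym j + α' j • yp j)⟫_ℂ).re
    linarith
  rw [inner_sub_right, inner_neg_right, Complex.sub_re, Complex.neg_re]
  -- Young against half the dissipation
  have hθ : 0 < 4 * Real.pi ^ 2 * lo' * freqNormSq k := by positivity
  have hy : 2 * (‖x‖ * (C * B)) ≤ 4 * Real.pi ^ 2 * lo' * freqNormSq k * ‖x‖ ^ 2 + (C * B) ^ 2 / (4 * Real.pi ^ 2 * lo' * freqNormSq k) := by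
    have h := two_mul_le_theta_sq_add (x := ‖x‖) (y := C * B) hθ
    linarith only [h]
  have hkx : 4 * Real.pi ^ 2 * lo' * κ * ‖x‖ ^ 2 ≤ 4 * Real.pi ^ 2 * lo' * freqNormSq k * ‖x‖ ^ 2 := by
    have : κ * ‖x‖ ^ 2 ≤ freqNormSq k * ‖x‖ ^ 2 := mul_le_mul_of_nonneg_right hk (sq_nonneg _)
    have hc : 0 ≤ 4 * Real.pi ^ 2 * lo' := by positivity
    nlinarith [mul_le_mul_of_nonneg_left this hc]
  have e : (C * B) ^ 2 = C ^ 2 * B ^ 2 := by ring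
  rw [e] at hy
  linarith [hdis, hlink, hy, hkx]

/-- **THE OUTER SHELL, POINTWISE.**  Cell problem with tensor `(1/n²)•𝔸`, `NearIso 𝔸 lo hi`, `lo > 0`, `2|ℓ| ≤ n`, `1 ≤ R`, `max|mⱼ|_∞ ≤ Mm ≤ R`;
if the shell modes `ℓ + n·w`, `w ∈ box R₂ \\ box R`, vanish at `t = 0` and every finite set of nonzero class indices has energy `≤ ζ` on `[0,t]`,
then `Σ_{w ∈ box R₂ \\ box R} ‖x_w(t)‖² ≤ k₀·(Σⱼ‖αⱼ‖²)·ζ/(π²·lo²·R²)` — the shell's own dissipation `4π²·lo·R²` against its links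
(`|cⱼ(k_w)| ≤ 2π√|k_w|²/n`, Young with half the dissipation; no skew cancellation). [cite: BedrossianCotiZelati2017, §2] [cite: Temam1984, Ch. III §1 Lemma 1.2] -/
theorem shell_energy_le (W₁ : LatticeWord k₀) {n : ℕ} (hn : n ≠ 0) {T : ℝ} {𝔸 : Torus.Visc4 (Fin 3)} {lo hi : ℝ}
    (h𝔸 : Torus.NearIso 𝔸 lo hi) (hlo : 0 < lo) {F : UnitAddTorus (Fin 3) → EuclideanSpace ℝ (Fin 3)}
    {u : ℝ → UnitAddTorus (Fin 3) → EuclideanSpace ℝ (Fin 3)}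
    (h : Torus.IsWeakTensorPassiveVectorOn 0 T ((1 / (n : ℝ) ^ 2) • 𝔸) (W₁.cell n) F u) (hF : Integrable F volume)
    {ℓ : Fin 3 → ℤ} (hℓ : 2 * Real.sqrt (freqNormSq ℓ) ≤ n) {R R₂ Mm : ℕ} (hR : 1 ≤ R) (hMR : Mm ≤ R)
    (hM : ∀ j i, |(W₁.phase j).m i| ≤ (Mm : ℤ))
    (h0 : ∀ w ∈ box R₂ \ box R, modeRep W₁ n ((1 / (n : ℝ) ^ 2) • 𝔸) F u (classFreq n ℓ w) 0 = 0)
    {ζ : ℝ} {t : ℝ} (ht : t ∈ Icc 0 T)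
    (hζ : ∀ s ∈ Icc 0 t, ∀ S : Finset (Fin 3 → ℤ), (∀ w ∈ S, w ≠ 0) →
      ∑ w ∈ S, ‖modeRep W₁ n ((1 / (n : ℝ) ^ 2) • 𝔸) F u (classFreq n ℓ w) s‖ ^ 2 ≤ ζ) :
    ∑ w ∈ box R₂ \ box R, ‖modeRep W₁ n ((1 / (n : ℝ) ^ 2) • 𝔸) F u (classFreq n ℓ w) t‖ ^ 2 ≤
      k₀ * (∑ j, ‖slotAmp W₁ j‖ ^ 2) * ζ / (Real.pi ^ 2 * lo ^ 2 * (R : ℝ) ^ 2) := by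
  classical
  set 𝔹 := (1 / (n : ℝ) ^ 2) • 𝔸 with h𝔹def
  set 𝒲 : Finset (Fin 3 → ℤ) := box R₂ \ box R with h𝒲
  have hn0 : (0 : ℝ) < n := by exact_mod_cast Nat.pos_of_ne_zero hn
  have hR0 : (0 : ℝ) < R := by exact_mod_cast hR
  have h𝔹 : Torus.NearIso 𝔹 (1 / (n : ℝ) ^ 2 * lo) (1 / (n : ℝ) ^ 2 * hi) := h𝔸.smul (by positivity)
  have hlo' : 0 < 1 / (n : ℝ) ^ 2 * lo := by positivity
  have hζ0 : 0 ≤ ζ := by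
    have h1 := hζ 0 ⟨le_rfl, ht.1⟩ ∅ (by simp)
    simpa using h1
  set A2 : ℝ := ∑ j, ‖slotAmp W₁ j‖ ^ 2 with hA2
  have hA20 : 0 ≤ A2 := Finset.sum_nonneg fun j _ => sq_nonneg _
  -- facts about shell indices
  have h𝒲mem : ∀ w ∈ 𝒲, w ∉ box R ∧ w ≠ 0 := fun w hw => by
    rw [h𝒲, Finset.mem_sdiff] at hw; exact ⟨hw.2, (mem_box.1 hw.1).2⟩
  have hκw : ∀ w ∈ 𝒲, ((n : ℝ) * R) ^ 2 ≤ freqNormSq (classFreq n ℓ w) := fun w hw =>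
    freqNormSq_classFreq_ge_of_not_mem_box hℓ (h𝒲mem w hw).1 (h𝒲mem w hw).2
  have hshift_ne : ∀ w ∈ 𝒲, ∀ j, w - (W₁.phase j).m ≠ 0 ∧ w + (W₁.phase j).m ≠ 0 := by
    intro w hw j
    obtain ⟨hwR, hw0⟩ := h𝒲mem w hw
    have hmbox : ∀ (m : Fin 3 → ℤ), (∀ i, |m i| ≤ (Mm : ℤ)) → m ≠ 0 → m ∈ box R := fun m hm hm0 =>
      mem_box.2 ⟨fun i => by have h1 := abs_le.1 (hm i); have h2 : (Mm : ℤ) ≤ R := (by exact_mod_cast hMR); constructor <;> omega, hm0⟩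
    constructor
    · intro h0'
      have : w = (W₁.phase j).m := sub_eq_zero.1 h0'
      exact hwR (this ▸ hmbox _ (hM j) (W₁.phase j).m_ne)
    · intro h0'
      have : w = -(W₁.phase j).m := eq_neg_of_add_eq_zero_left h0'
      refine hwR (this ▸ hmbox _ (fun i => ?_) (neg_ne_zero.2 (W₁.phase j).m_ne))
      rw [Pi.neg_apply, abs_neg]; exact hM j i
  -- the energy functional and its derivative
  set e : ℝ → ℝ := fun s => ∑ w ∈ 𝒲, ‖modeRep W₁ n 𝔹 F u (classFreq n ℓ w) s‖ ^ 2 with hedef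
  set σ : ℝ := 4 * Real.pi ^ 2 * lo * (R : ℝ) ^ 2 with hσ
  set G : ℝ := 4 * k₀ * A2 * ζ / lo with hG
  have hσ0 : 0 < σ := by positivity
  have hG0 : 0 ≤ G := by positivity
  have hT : t ≤ T := ht.2
  have hec : ContinuousOn e (Icc 0 t) :=
    (continuousOn_finsetSum 𝒲 fun w _ => ((continuousOn_modeRep W₁ n (ht.1.trans hT) h (classFreq n ℓ w)).norm).pow 2).mono
      (Icc_subset_Icc_right hT)
  have hd : ∀ s ∈ Ioo 0 t, ∃ φ : ℝ, HasDerivWithinAt e φ (Ici s) s ∧ φ ≤ -σ * e s + G := by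
    intro s hs
    have hsT : s ∈ Ioo 0 T := ⟨hs.1, hs.2.trans_le hT⟩
    have hsI : s ∈ Icc 0 T := ⟨hs.1.le, hsT.2.le⟩
    have hder := HasDerivAt.fun_sum fun w (_ : w ∈ 𝒲) => hasDerivAt_norm_sq_modeRep W₁ n h hF (classFreq n ℓ w) hsT
    refine ⟨_, hder.hasDerivWithinAt, ?_⟩
    -- each shell mode
    have hterm : ∀ w ∈ 𝒲, 2 * (⟪modeRep W₁ n 𝔹 F u (classFreq n ℓ w) s,
        (-(((4 * Real.pi ^ 2 : ℝ) : ℂ) • transversalProj (classFreq n ℓ w)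
            (Torus.symbT (Torus.majorTranspose 𝔹) (classFreq n ℓ w) (modeRep W₁ n 𝔹 F u (classFreq n ℓ w) s))) -
          ∑ j, linkCoeff W₁ n (classFreq n ℓ w) j s • transversalProj (classFreq n ℓ w)
            ((Complex.exp ((W₁.phase j).φ * Complex.I) * (1 / (2 * ((2 * Real.pi * ‖latticeVec (W₁.phase j).m‖ : ℝ) : ℂ) * Complex.I))) •
                modeRep W₁ n 𝔹 F u (classFreq n ℓ w - fun i => (W₁.phase j).m i * n) s +
              (starRingEnd ℂ (Complex.exp ((W₁.phase j).φ * Complex.I)) *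
                  (-(1 / (2 * ((2 * Real.pi * ‖latticeVec (W₁.phase j).m‖ : ℝ) : ℂ) * Complex.I)))) •
                modeRep W₁ n 𝔹 F u (classFreq n ℓ w + fun i => (W₁.phase j).m i * n) s))⟫_ℂ).re ≤
        -σ * ‖modeRep W₁ n 𝔹 F u (classFreq n ℓ w) s‖ ^ 2 + (2 * A2 / lo) * ∑ j, (‖modeRep W₁ n 𝔹 F u (classFreq n ℓ (w - (W₁.phase j).m)) s‖ ^ 2 +
          ‖modeRep W₁ n 𝔹 F u (classFreq n ℓ (w + (W₁.phase j).m)) s‖ ^ 2) := by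
      intro w hw
      have hκ : 0 < ((n : ℝ) * R) ^ 2 := by positivity
      have hxT : kdot (classFreq n ℓ w) (modeRep W₁ n 𝔹 F u (classFreq n ℓ w) s) = 0 :=
        CellChain.kdot_modeRep W₁ n (hs.1.le.trans hsT.2.le) h (classFreq n ℓ w) hsI
      have hmain := two_re_inner_rhs_le h𝔹 hlo' hκ (hκw w hw) hxT Finset.univ (fun j => linkCoeff W₁ n (classFreq n ℓ w) j s)
        (fun j => Complex.exp ((W₁.phase j).φ * Complex.I) * (1 / (2 * ((2 * Real.pi * ‖latticeVec (W₁.phase j).m‖ : ℝ) : ℂ) * Complex.I)))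
        (fun j => starRingEnd ℂ (Complex.exp ((W₁.phase j).φ * Complex.I)) *
          (-(1 / (2 * ((2 * Real.pi * ‖latticeVec (W₁.phase j).m‖ : ℝ) : ℂ) * Complex.I))))
        (fun j => modeRep W₁ n 𝔹 F u (classFreq n ℓ w - fun i => (W₁.phase j).m i * n) s)
        (fun j => modeRep W₁ n 𝔹 F u (classFreq n ℓ w + fun i => (W₁.phase j).m i * n) s)
        (C := 2 * Real.pi * (Real.sqrt (freqNormSq (classFreq n ℓ w)) / n)) (by positivity)
        (fun j _ => norm_linkCoeff_classFreq_le W₁ n ℓ w j s) (fun j _ => by rw [← slotAmp_def, ← conj_slotAmp, Complex.norm_conj])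
      refine hmain.trans ?_
      -- rewrite the neighbours and the amplitudes (on the real-valued side only)
      have hα : ∀ j, ‖Complex.exp ((W₁.phase j).φ * Complex.I) * (1 / (2 * ((2 * Real.pi * ‖latticeVec (W₁.phase j).m‖ : ℝ) : ℂ) * Complex.I))‖ =
          ‖slotAmp W₁ j‖ := fun j => by rw [slotAmp_def]
      have hnbm : ∀ m : Fin 3 → ℤ, modeRep W₁ n 𝔹 F u (classFreq n ℓ w - fun i => m i * n) s = modeRep W₁ n 𝔹 F u (classFreq n ℓ (w - m)) s :=
        fun m => by rw [classFreq_sub]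
      have hnbp : ∀ m : Fin 3 → ℤ, modeRep W₁ n 𝔹 F u (classFreq n ℓ w + fun i => m i * n) s = modeRep W₁ n 𝔹 F u (classFreq n ℓ (w + m)) s :=
        fun m => by rw [classFreq_add]
      simp only [hα, hnbm, hnbp]
      -- the dissipation coefficient and the link constant
      have hdisc : -(4 * Real.pi ^ 2 * (1 / (n : ℝ) ^ 2 * lo) * ((n : ℝ) * R) ^ 2) = -σ := by rw [hσ]; field_simp
      have hk0 : freqNormSq (classFreq n ℓ w) ≠ 0 := (hκ.trans_le (hκw w hw)).ne'
      set Cw : ℝ := 2 * Real.pi * (Real.sqrt (freqNormSq (classFreq n ℓ w)) / n) with hCw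
      set D : ℝ := 4 * Real.pi ^ 2 * (1 / (n : ℝ) ^ 2 * lo) * freqNormSq (classFreq n ℓ w) with hD
      set Bs : ℝ := ∑ j, ‖slotAmp W₁ j‖ * (‖modeRep W₁ n 𝔹 F u (classFreq n ℓ (w - (W₁.phase j).m)) s‖ +
          ‖modeRep W₁ n 𝔹 F u (classFreq n ℓ (w + (W₁.phase j).m)) s‖) with hBs
      set N : ℝ := ∑ j, (‖modeRep W₁ n 𝔹 F u (classFreq n ℓ (w - (W₁.phase j).m)) s‖ ^ 2 +
            ‖modeRep W₁ n 𝔹 F u (classFreq n ℓ (w + (W₁.phase j).m)) s‖ ^ 2) with hN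
      have hC2 : Cw ^ 2 / D = 1 / lo := by
        have hsq : Real.sqrt (freqNormSq (classFreq n ℓ w)) ^ 2 = freqNormSq (classFreq n ℓ w) := Real.sq_sqrt (freqNormSq_nonneg _)
        rw [hCw, hD, div_eq_div_iff (by positivity) hlo.ne', mul_pow, mul_pow, div_pow, hsq]
        field_simp
        norm_num
      have hsum : Bs ^ 2 ≤ 2 * A2 * N := by
        rw [hBs, hA2, hN]
        exact sq_sum_two_le (fun j => ‖slotAmp W₁ j‖) (fun j => ‖modeRep W₁ n 𝔹 F u (classFreq n ℓ (w - (W₁.phase j).m)) s‖)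
          (fun j => ‖modeRep W₁ n 𝔹 F u (classFreq n ℓ (w + (W₁.phase j).m)) s‖)
      have hstep : Cw ^ 2 * Bs ^ 2 / D ≤ (2 * A2 / lo) * N := by
        calc Cw ^ 2 * Bs ^ 2 / D = Bs ^ 2 * (Cw ^ 2 / D) := by ring
          _ = Bs ^ 2 * (1 / lo) := by rw [hC2]
          _ ≤ (2 * A2 * N) * (1 / lo) := mul_le_mul_of_nonneg_right hsum (by positivity)
          _ = (2 * A2 / lo) * N := by ring
      rw [hdisc]
      linarith [hstep]
    -- sum over the shell
    have hsum𝒲 : ∑ w ∈ 𝒲, (-σ * ‖modeRep W₁ n 𝔹 F u (classFreq n ℓ w) s‖ ^ 2 + (2 * A2 / lo) *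
        ∑ j, (‖modeRep W₁ n 𝔹 F u (classFreq n ℓ (w - (W₁.phase j).m)) s‖ ^ 2 + ‖modeRep W₁ n 𝔹 F u (classFreq n ℓ (w + (W₁.phase j).m)) s‖ ^ 2)) ≤
        -σ * e s + G := by
      rw [Finset.sum_add_distrib, ← Finset.mul_sum, ← Finset.mul_sum]
      have hnbζ : ∑ w ∈ 𝒲, ∑ j, (‖modeRep W₁ n 𝔹 F u (classFreq n ℓ (w - (W₁.phase j).m)) s‖ ^ 2 +
          ‖modeRep W₁ n 𝔹 F u (classFreq n ℓ (w + (W₁.phase j).m)) s‖ ^ 2) ≤ 2 * k₀ * ζ := by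
        rw [Finset.sum_comm]
        have hj : ∀ j : Fin k₀, ∑ w ∈ 𝒲, (‖modeRep W₁ n 𝔹 F u (classFreq n ℓ (w - (W₁.phase j).m)) s‖ ^ 2 +
            ‖modeRep W₁ n 𝔹 F u (classFreq n ℓ (w + (W₁.phase j).m)) s‖ ^ 2) ≤ 2 * ζ := by
          intro j
          rw [Finset.sum_add_distrib]
          have hsI' : s ∈ Icc 0 t := ⟨hs.1.le, hs.2.le⟩
          have hm : ∑ w ∈ 𝒲, ‖modeRep W₁ n 𝔹 F u (classFreq n ℓ (w - (W₁.phase j).m)) s‖ ^ 2 ≤ ζ := by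
            rw [← Finset.sum_image (s := 𝒲) (g := fun w => w - (W₁.phase j).m)
              (f := fun w' => ‖modeRep W₁ n 𝔹 F u (classFreq n ℓ w') s‖ ^ 2) (fun w _ w' _ hww' => sub_left_injective hww')]
            refine hζ s hsI' _ fun w' hw' => ?_
            obtain ⟨w, hw, rfl⟩ := Finset.mem_image.1 hw'
            exact (hshift_ne w hw j).1
          have hp : ∑ w ∈ 𝒲, ‖modeRep W₁ n 𝔹 F u (classFreq n ℓ (w + (W₁.phase j).m)) s‖ ^ 2 ≤ ζ := by
            rw [← Finset.sum_image (s := 𝒲) (g := fun w => w + (W₁.phase j).m)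
              (f := fun w' => ‖modeRep W₁ n 𝔹 F u (classFreq n ℓ w') s‖ ^ 2) (fun w _ w' _ hww' => add_left_injective _ hww')]
            refine hζ s hsI' _ fun w' hw' => ?_
            obtain ⟨w, hw, rfl⟩ := Finset.mem_image.1 hw'
            exact (hshift_ne w hw j).2
          linarith
        calc _ ≤ ∑ _j : Fin k₀, 2 * ζ := Finset.sum_le_sum fun j _ => hj j
          _ = 2 * k₀ * ζ := by rw [Finset.sum_const, Finset.card_univ, Fintype.card_fin, nsmul_eq_mul]; ring
      have h2 : 2 * A2 / lo * ∑ w ∈ 𝒲, ∑ j, (‖modeRep W₁ n 𝔹 F u (classFreq n ℓ (w - (W₁.phase j).m)) s‖ ^ 2 +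
          ‖modeRep W₁ n 𝔹 F u (classFreq n ℓ (w + (W₁.phase j).m)) s‖ ^ 2) ≤ G := by
        calc _ ≤ 2 * A2 / lo * (2 * k₀ * ζ) := mul_le_mul_of_nonneg_left hnbζ (by positivity)
          _ = G := by rw [hG]; ring
      have he : -σ * ∑ w ∈ 𝒲, ‖modeRep W₁ n 𝔹 F u (classFreq n ℓ w) s‖ ^ 2 = -σ * e s := by rw [hedef]
      linarith [h2, he]
    exact (Finset.sum_le_sum hterm).trans hsum𝒲
  -- Grönwall from `e 0 = 0`
  have hgr := le_exp_integral_of_deriv_right_le_Ioo (T := t) (σ := σ) (g := fun _ => G) hec continuousOn_const hd ⟨ht.1, le_rfl⟩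
  have he0 : e 0 = 0 := by
    rw [hedef]
    exact Finset.sum_eq_zero fun w hw => by rw [h0 w (by rw [h𝒲] at hw; exact hw)]; simp
  rw [he0, mul_zero, zero_add, intervalIntegral.integral_mul_const] at hgr
  have hint := integral_exp_neg_sub_le_inv hσ0 t
  have hfin : (∫ s in (0:ℝ)..t, Real.exp (-(σ * (t - s)))) * G ≤ 1 / σ * G := mul_le_mul_of_nonneg_right hint hG0
  have hval : 1 / σ * G = k₀ * A2 * ζ / (Real.pi ^ 2 * lo ^ 2 * (R : ℝ) ^ 2) := by
    rw [hσ, hG]; field_simp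
  change e t ≤ _
  exact hgr.trans (hfin.trans (le_of_eq hval))

/-! ## §4 The tail energy, pointwise, for the single-mode datum -/

/-- **THE TAIL ENERGY, POINTWISE** (single-mode datum `Re e_ℓ·p`, `p ⊥ ℓ`, `ℓ ≠ 0`, `2|ℓ| < n`, `1 ≤ R`, `max|mⱼ|_∞ ≤ Mm ≤ R`): for every
`t ∈ [0,T]`, `tailEnergy t ≤ 4k₀(Σⱼ‖αⱼ‖²) · k₀(Σⱼ‖αⱼ‖²)·ζ/(π²lo²R²)` with `ζ = 64(√|ℓ|²/n)²‖F‖²_{L²}(Σⱼ‖αⱼ‖)²/(π²lo²)` — of relative size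
`ξ²/(lo⁴R²)`, i.e. `O(ξ²ν²)` at `lo ∼ ν`, `R = ⌈ν⁻³⌉`. [cite: BedrossianCotiZelati2017, §2] [cite: MajdaKramer1999, §2.2.1.3] -/
theorem tailEnergy_le_pointwise (W₁ : LatticeWord k₀) {n : ℕ} (hn : n ≠ 0) {T : ℝ} (hT : 0 < T) {𝔸 : Torus.Visc4 (Fin 3)} {lo hi : ℝ}
    (h𝔸 : Torus.NearIso 𝔸 lo hi) (hlo : 0 < lo) {ℓ : Fin 3 → ℤ} (hℓ0 : ℓ ≠ 0) (hℓ : 2 * Real.sqrt (freqNormSq ℓ) < n)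
    {p : EuclideanSpace ℝ (Fin 3)} (hp : ⟪p, Torus.latticeVec ℓ⟫_ℝ = 0) {u : ℝ → UnitAddTorus (Fin 3) → EuclideanSpace ℝ (Fin 3)}
    (h : Torus.IsWeakTensorPassiveVectorOn 0 T ((1 / (n : ℝ) ^ 2) • 𝔸) (W₁.cell n) (fun x => (UnitAddTorus.mFourier ℓ x).re • p) u)
    {R Mm : ℕ} (hR : 1 ≤ R) (hMR : Mm ≤ R) (hM : ∀ j i, |(W₁.phase j).m i| ≤ (Mm : ℤ)) {t : ℝ} (ht : t ∈ Icc 0 T) :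
    tailEnergy W₁ n ℓ 𝔸 R (fun x => (UnitAddTorus.mFourier ℓ x).re • p) u t ≤
      4 * k₀ * (∑ j, ‖slotAmp W₁ j‖ ^ 2) *
        (k₀ * (∑ j, ‖slotAmp W₁ j‖ ^ 2) *
          (64 * (Real.sqrt (freqNormSq ℓ) / n) ^ 2 * (∫ x, ‖(UnitAddTorus.mFourier ℓ x).re • p‖ ^ 2) * (∑ j, ‖slotAmp W₁ j‖) ^ 2 /
            (Real.pi ^ 2 * lo ^ 2)) / (Real.pi ^ 2 * lo ^ 2 * (R : ℝ) ^ 2)) := by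
  have hFi : Integrable (fun x : UnitAddTorus (Fin 3) => (UnitAddTorus.mFourier ℓ x).re • p) volume :=
    (memLp_two_of_memSobolev_one_complexify (memSobolev_one_singleMode ℓ p)).integrable one_le_two
  have h0 : ∀ w ∈ box (R + Mm) \ box R, modeRep W₁ n ((1 / (n : ℝ) ^ 2) • 𝔸) (fun x => (UnitAddTorus.mFourier ℓ x).re • p) u
      (classFreq n ℓ w) 0 = 0 := by
    intro w hw
    rw [Finset.mem_sdiff] at hw
    have hw0 : w ≠ 0 := (mem_box.1 hw.1).2
    rw [modeRep_zero, mFourierCoeff_singleMode_of_ne (classFreq_ne_self' hn ℓ hw0) (classFreq_ne_neg_self' hℓ hw0) p, map_zero]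
  have hA0 : 0 ≤ 4 * (k₀ : ℝ) * ∑ j, ‖slotAmp W₁ j‖ ^ 2 := by
    have := Finset.sum_nonneg fun j (_ : j ∈ Finset.univ) => sq_nonneg ‖slotAmp W₁ j‖; positivity
  refine (tailEnergy_le_shell_sum W₁ n ℓ 𝔸 hM _ u t).trans (mul_le_mul_of_nonneg_left ?_ hA0)
  exact shell_energy_le W₁ hn h𝔸 hlo h hFi hℓ.le hR hMR hM h0 ht
    fun s hs S hS => sideband_energy_le W₁ hn hT h𝔸 hlo hℓ0 hℓ hp h ⟨hs.1, hs.2.trans ht.2⟩ S hS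

end Summit.AnomalousDissipation.AnomalousDissipation.Theorems.SolenoidalFractalHomogenisation.LagrangianStep.Sideband

end
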